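import Summits.CriticalPhenomena.PercolationContinuityZ3.Theorems.PercFiniteBoxLRORenormaliseFromLinearLROBlockDefs
import Summits.CriticalPhenomena.PercolationContinuityZ3.Theorems.PercFiniteBoxLRORenormaliseFromLinearLROStubCoarseDependent
import Summits.CriticalPhenomena.PercolationContinuityZ3.Theorems.PercFiniteBoxLRORenormaliseFromLinearLROStubCoarseDensity

/-!
# `stub_blockLawInputs` of line `registered` (crux `PercFiniteBoxLRO.RenormaliseFromLinearLRO`,
# stmt-CriticalPhenomena-0857, reshape 2): dependence and density of the coarse law of a GENERIC block event

Registered stub `stub_blockLawInputs` of the lead's skeleton: the two hypotheses of the proved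
dependent-percolation theorem
`Literature.Probability.Percolation.DuminilCopinSidoraviciusTassion2016_dependentPercolation_holds`
for the planar coarse-graining `blockLaw n E p = (blockCfg n E)_* P_p` (objects file
`PercFiniteBoxLRORenormaliseFromLinearLROBlockDefs.lean`) of an ARBITRARY measurable block event
`E ⊆ {0,1}^{E(ℤ³)}`:

* (i) `D`-DEPENDENCE: if `E` is determined by the pairs inside `Λ(R) = box 3 R` and `2R < D n`, then
  measurable events `A`, `B` of the coarse configuration determined by finite coarse edge sets `F₁`, `F₂`
  whose vertices are pairwise at planar sup-distance `≥ D` are independent under `blockLaw n E p`.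
  Indeed `blockEvent n E a` is determined by the pairs inside `blockCentre n a + Λ(R)`
  (`blockEvent_determinedBy`), so `blockCfg n E ⁻¹' A` is determined by the pairs inside the blocks of the
  endpoints of the edges of `F₁` (`blockCfg_determinedBy_preimage`); two such regions for `F₁`, `F₂` are
  DISJOINT (`blockEvent_disjoint_regions`: a common pair has a vertex `v` with `|v_i − n a_i| ≤ R` and
  `|v_i − n b_i| ≤ R` for `i = 0, 1`, so `n D ≤ n |a_i − b_i| ≤ 2R < D n` for the far coordinate `i`);
  events determined by disjoint sets of pairs are independent under the product measure
  (`bondPercolation_inter_of_disjoint`, `FiniteEnergy.lean`), and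
  `blockLaw n E p X = P_p (blockCfg n E ⁻¹' X)` (`Measure.map_apply`).
* (ii) DENSITY: every lattice edge `e = {a, a + eᵢ}` of `ℤ²` (`exists_base_of_mem_edgeSet`) is open in the
  coarse configuration with probability `(blockLaw n E p) {σ | e ∈ σ} ≥ 2 P_p(E) − 1`:
  `map_measureReal_apply`, the inclusion
  `blockEvent n E a ∩ blockEvent n E (a + eᵢ) ⊆ blockCfg n E ⁻¹' {σ | e ∈ σ}` (`mk_mem_blockCfg_iff`),
  translation invariance `real_blockEvent`, and inclusion–exclusion `measureReal_add_sub_one_le_inter`.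

This is the port of the landed `stub_coarseDependent` / `stub_coarseDensity` (the instance `E = goodBox n`,
`R = n`, `D = 3`) to a generic block event. Sources: H. Duminil-Copin, V. Sidoravicius, V. Tassion,
Comm. Pure Appl. Math. 69 (2016) §2.2 (coarse graining into a dependent planar percolation); G. Grimmett,
*Percolation*, 2nd ed. (1999), §7.4 p.178, (7.57)–(7.58).
-/

noncomputable section

namespace Summit.CriticalPhenomena.PercolationContinuityZ3.Theorems.RenormaliseFromLinearLRO

open Literature.Probability.Percolation Literature.Probability.LatticeModels
open MeasureTheory

/-! ## (i) Dependence -/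

/-- The block event of `a` is determined by the pairs inside the block `blockCentre n a + Λ(R)` (the pairs
whose shift by `-blockCentre n a` lies in `(box 3 R).sym2`) whenever `E` is determined by the pairs inside
`Λ(R)` (pull back along the shift, `determinedBy_preimage_relabel_pairs`). -/
theorem blockEvent_determinedBy (n : ℕ) {R : ℕ} {E : Set (BondConfig (Site 3))}
    (hE : DeterminedBy E (↑((box 3 R).sym2) : Set (Sym2 (Site 3)))) (a : Site 2) :
    DeterminedBy (blockEvent n E a)
      ((sym2Equiv (Site.shift (-blockCentre n a))) ⁻¹' (↑((box 3 R).sym2) : Set (Sym2 (Site 3)))) :=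
  determinedBy_preimage_relabel_pairs _ hE

/-- Events of the coarse configuration of `E` determined by the coarse edges in `F` pull back under
`blockCfg n E` to events determined by the pairs inside the blocks (of radius `R`) of the endpoints of the
edges of `F` (DST 2016 §2.2; Grimmett 1999 §7.4 p.178: "whether a block is good depends only on the edges
of the block"). -/
theorem blockCfg_determinedBy_preimage (n : ℕ) {R : ℕ} {E : Set (BondConfig (Site 3))}
    (hE : DeterminedBy E (↑((box 3 R).sym2) : Set (Sym2 (Site 3)))) {A : Set (BondConfig (Site 2))}
    {F : Finset (Sym2 (Site 2))} (hA : DeterminedBy A (↑F : Set (Sym2 (Site 2)))) :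
    DeterminedBy (blockCfg n E ⁻¹' A)
      (⋃ e ∈ F, ⋃ a : Site 2, ⋃ (_ : a ∈ e),
        (sym2Equiv (Site.shift (-blockCentre n a))) ⁻¹' (↑((box 3 R).sym2) : Set (Sym2 (Site 3)))) := by
  rw [determinedBy_iff] at hA ⊢
  intro ω ω' h
  have hloc : ∀ e ∈ F, ∀ a ∈ e, (ω ∈ blockEvent n E a ↔ ω' ∈ blockEvent n E a) := fun e he a ha =>
    (determinedBy_iff _ _).1 ((blockEvent_determinedBy n hE a).mono fun d hd =>
      Set.mem_biUnion (Finset.mem_coe.2 he) (Set.mem_iUnion.2 ⟨a, Set.mem_iUnion.2 ⟨ha, hd⟩⟩)) ω ω' h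
  have key : ∀ e ∈ F, (e ∈ blockCfg n E ω ↔ e ∈ blockCfg n E ω') := by
    intro e he
    simp only [blockCfg, Set.mem_setOf_eq]
    refine exists_congr fun x => exists_congr fun i => and_congr_right fun hex => ?_
    exact and_congr (hloc e he x (hex ▸ Sym2.mem_mk_left _ _))
      (hloc e he _ (hex ▸ Sym2.mem_mk_right _ _))
  simp only [Set.mem_preimage]
  apply hA
  ext e
  simp only [Set.mem_inter_iff, Finset.mem_coe]
  constructor
  · rintro ⟨h1, h2⟩; exact ⟨(key e h2).1 h1, h2⟩
  · rintro ⟨h1, h2⟩; exact ⟨(key e h2).2 h1, h2⟩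

/-- **`D`-dependence of the blocks of radius `R`, `2R < D n`**: the regions of pairs of two families of
coarse edges whose vertices are pairwise at planar sup-distance `≥ D` are disjoint — a common pair would
have a vertex `v` with `|v_i − n a_i| ≤ R` and `|v_i − n b_i| ≤ R` (`i = 0, 1`), whence
`n D ≤ n |a_i − b_i| ≤ 2R < D n` for the far coordinate `i`. DST 2016 §2.2 / Grimmett 1999 §7.4 p.178. -/
theorem blockEvent_disjoint_regions {n R D : ℕ} (hRD : 2 * R < D * n) {F₁ F₂ : Finset (Sym2 (Site 2))}
    (hfar : ∀ e₁ ∈ F₁, ∀ e₂ ∈ F₂, ∀ a ∈ e₁, ∀ b ∈ e₂, (D : ℤ) ≤ max |a 0 - b 0| |a 1 - b 1|) :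
    Disjoint
      (⋃ e ∈ F₁, ⋃ a : Site 2, ⋃ (_ : a ∈ e),
        (sym2Equiv (Site.shift (-blockCentre n a))) ⁻¹' (↑((box 3 R).sym2) : Set (Sym2 (Site 3))))
      (⋃ e ∈ F₂, ⋃ a : Site 2, ⋃ (_ : a ∈ e),
        (sym2Equiv (Site.shift (-blockCentre n a))) ⁻¹' (↑((box 3 R).sym2) : Set (Sym2 (Site 3)))) := by
  rw [Set.disjoint_left]
  intro d hd1 hd2
  simp only [Set.mem_iUnion, Set.mem_preimage, Finset.mem_coe, sym2Equiv_apply, exists_prop] at hd1 hd2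
  obtain ⟨e₁, he₁, a, ha, hd₁⟩ := hd1
  obtain ⟨e₂, he₂, b, hb, hd₂⟩ := hd2
  have h3 := hfar e₁ he₁ e₂ he₂ a ha b hb
  obtain ⟨v, hv⟩ : ∃ v, v ∈ d := ⟨d.out.1, Sym2.out_fst_mem d⟩
  have hv₁ : v + -blockCentre n a ∈ box 3 R :=
    Finset.mem_sym2_iff.1 hd₁ _ (Sym2.mem_map.2 ⟨v, hv, rfl⟩)
  have hv₂ : v + -blockCentre n b ∈ box 3 R :=
    Finset.mem_sym2_iff.1 hd₂ _ (Sym2.mem_map.2 ⟨v, hv, rfl⟩)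
  rw [mem_box] at hv₁ hv₂
  have h0 := hv₁ 0
  have h1 := hv₁ 1
  have h0' := hv₂ 0
  have h1' := hv₂ 1
  simp only [blockCentre, Pi.add_apply, Pi.neg_apply, Matrix.cons_val_zero,
    Matrix.cons_val_one] at h0 h1 h0' h1'
  have hn0 : (0 : ℤ) ≤ n := by positivity
  have hcp : (n : ℤ) * D ≤ |(n : ℤ) * a 0 - n * b 0| ∨ (n : ℤ) * D ≤ |(n : ℤ) * a 1 - n * b 1| := by
    rcases le_max_iff.1 h3 with h | h
    · left
      rw [← mul_sub, abs_mul, abs_of_nonneg hn0]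
      exact mul_le_mul_of_nonneg_left h hn0
    · right
      rw [← mul_sub, abs_mul, abs_of_nonneg hn0]
      exact mul_le_mul_of_nonneg_left h hn0
  have hRD' : 2 * (R : ℤ) < (n : ℤ) * D := by
    rw [mul_comm (n : ℤ) (D : ℤ)]
    exact_mod_cast hRD
  rw [le_abs, le_abs] at hcp
  omega

/-! ## (ii) Density -/

/-- Both blocks of a presented coarse edge satisfying `E` forces the coarse edge to be open:
`blockEvent n E a ∩ blockEvent n E (a + eᵢ) ⊆ blockCfg n E ⁻¹' {σ | s(a, a + eᵢ) ∈ σ}`. -/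
theorem blockEvent_inter_subset_preimage_blockCfg (n : ℕ) (E : Set (BondConfig (Site 3))) (a : Site 2)
    (i : Fin 2) :
    blockEvent n E a ∩ blockEvent n E (a + Pi.single i 1) ⊆
      blockCfg n E ⁻¹' {σ : BondConfig (Site 2) | s(a, a + Pi.single i 1) ∈ σ} :=
  fun ω hω => (mk_mem_blockCfg_iff n E ω a i).2 hω

/-- The density bound for a presented lattice edge:
`(blockLaw n E p) {σ | s(a, a + eᵢ) ∈ σ} ≥ 2 P_p(E) − 1` (translation invariance `real_blockEvent` and
inclusion–exclusion; Grimmett 1999 §7.4 p.178). -/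
theorem blockLaw_real_mk_mem_ge (p : unitInterval) (n : ℕ) {E : Set (BondConfig (Site 3))}
    (hE : MeasurableSet E) (a : Site 2) (i : Fin 2) :
    2 * (bondPercolation (zdGraph 3) p).real E - 1 ≤
      (blockLaw n E p).real {σ | s(a, a + Pi.single i 1) ∈ σ} := by
  rw [blockLaw, map_measureReal_apply (measurable_blockCfg n hE) (measurableSet_mem _)]
  calc 2 * (bondPercolation (zdGraph 3) p).real E - 1
      = (bondPercolation (zdGraph 3) p).real (blockEvent n E a) +
          (bondPercolation (zdGraph 3) p).real (blockEvent n E (a + Pi.single i 1)) - 1 := by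
        rw [real_blockEvent, real_blockEvent]; ring
    _ ≤ (bondPercolation (zdGraph 3) p).real (blockEvent n E a ∩ blockEvent n E (a + Pi.single i 1)) :=
        measureReal_add_sub_one_le_inter _ (measurableSet_blockEvent n hE _)
    _ ≤ (bondPercolation (zdGraph 3) p).real
          (blockCfg n E ⁻¹' {σ : BondConfig (Site 2) | s(a, a + Pi.single i 1) ∈ σ}) :=
        measureReal_mono (blockEvent_inter_subset_preimage_blockCfg n E a i)

/-! ## The registered stub -/

/-- **Registered stub `stub_blockLawInputs` of crux stmt-CriticalPhenomena-0857 (line `registered`,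
reshape 2)**: for ANY measurable block event `E`, the coarse law `blockLaw n E p` of the planar layer of
blocks (i) makes measurable events determined by finite coarse edge sets at planar sup-distance `≥ D`
independent whenever `E` is determined by the pairs inside `Λ(R)` and `2R < D n` (the two regions of pairs
are disjoint, `blockEvent_disjoint_regions`, and the product measure `P_p` makes events of disjoint sets of
pairs independent, `bondPercolation_inter_of_disjoint`), and (ii) opens every lattice edge of `ℤ²` with
probability `≥ 2 P_p(E) − 1` (`blockLaw_real_mk_mem_ge`). These are exactly the two hypotheses of
`DuminilCopinSidoraviciusTassion2016_dependentPercolation_holds`. DST 2016 §2.2; Grimmett 1999 §7.4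
(7.57)–(7.58). -/
theorem stub_blockLawInputs :
    (∀ (p : unitInterval) (n R D : ℕ) (E : Set (BondConfig (Site 3))), 2 * R < D * n →
        MeasurableSet E → DeterminedBy E (↑((box 3 R).sym2) : Set (Sym2 (Site 3))) →
        ∀ (F₁ F₂ : Finset (Sym2 (Site 2))),
          (∀ e₁ ∈ F₁, ∀ e₂ ∈ F₂, ∀ a ∈ e₁, ∀ b ∈ e₂, (D : ℤ) ≤ max |a 0 - b 0| |a 1 - b 1|) →
          ∀ (A B : Set (BondConfig (Site 2))), DeterminedBy A (↑F₁ : Set (Sym2 (Site 2))) →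
            DeterminedBy B (↑F₂ : Set (Sym2 (Site 2))) → MeasurableSet A → MeasurableSet B →
            blockLaw n E p (A ∩ B) = blockLaw n E p A * blockLaw n E p B) ∧
    (∀ (p : unitInterval) (n : ℕ) (E : Set (BondConfig (Site 3))), MeasurableSet E →
        ∀ e ∈ (zdGraph 2).edgeSet,
          2 * (bondPercolation (zdGraph 3) p).real E - 1 ≤ (blockLaw n E p).real {σ | e ∈ σ}) := by
  refine ⟨?_, ?_⟩
  · intro p n R D E hRD hEm hE F₁ F₂ hfar A B hA hB hAm hBm
    simp only [blockLaw, Measure.map_apply (measurable_blockCfg n hEm) (hAm.inter hBm),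
      Measure.map_apply (measurable_blockCfg n hEm) hAm, Measure.map_apply (measurable_blockCfg n hEm) hBm,
      Set.preimage_inter]
    exact bondPercolation_inter_of_disjoint (zdGraph 3) p (blockEvent_disjoint_regions hRD hfar)
      (blockCfg_determinedBy_preimage n hE hA) (blockCfg_determinedBy_preimage n hE hB)
      (hAm.preimage (measurable_blockCfg n hEm)) (hBm.preimage (measurable_blockCfg n hEm))
  · intro p n E hE e he
    obtain ⟨a, i, rfl⟩ := exists_base_of_mem_edgeSet he
    exact blockLaw_real_mk_mem_ge p n hE a i

end Summit.CriticalPhenomena.PercolationContinuityZ3.Theorems.RenormaliseFromLinearLRO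

end
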